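/-
Copyright (c) 2026 the pub-hodgecm-mathlib formalisation cell (harness21).  Prover seat hodgecm-mathlib-K2E3-p14 (g6), Track B «K2-LIT» ∕ h413
(`stmt-HodgeConjecture-24833`), line `K2_E3_EllipticInputs`, road (11-3-split-nsc), leaf (nsc-S-A′) «principal-block standard span», brick A2′ (JH):
EVERY CONSTITUENT OF A FINITE-LENGTH REPRESENTATION IS ONE OF THE FACTORS OF ANY COVERING CHAIN (JORDAN–HÖLDER, UNIQUENESS HALF).  2026-09-04.
-/
import Summits.HodgeConjecture.HodgeConjecture.Theorems.K2E3SmoothTraceCompositionSeries   -- ★ A2: covering chains, irreducible subquotients, trace telescoping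
import Literature.NumberTheory.Automorphic.ParabolicIndGLNoSupercuspidalSubquotient         -- ★ `IntertwiningMap.surjective_or_eq_zero`
import HarnessLib

/-!
# K2_E3 road (h413), (11-3-split-nsc) leaf (nsc-S-A′), brick A2′ (JH) — every constituent is a factor of any covering chain

Cell `pub/hodgecm-mathlib` (D-0151), Track B, seat K2E3-p14 (g6); leaf architecture K2E3-p25 (g0) (`MEMO-SA-architecture.v1`, brick A2; «A2′ JH-uniqueness: YES
please, the assembly needs «every constituent is one of the `r i`»», K2 bus 2026-09-04 08:40:11Z).  `--supports stmt-HodgeConjecture-24833 --as helper`; THEOREMS ONLY;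
never imports `Cruxes/…/Lines`.  COUNT-NEUTRAL.  General topological group `G : Type` (as ★ A2).

THE MATHEMATICS ([BernsteinZelevinsky1976, §2.3]; [Casselman1995, §2.1]; Jordan–Hölder, uniqueness half, in the Schreier form).  Let `0 = M₀ ⋖ M₁ ⋖ ⋯ ⋖ M_n = V`
be a covering chain of subrepresentations of `π` and `N₂ ≤ N₁` subrepresentations with `N₁∕N₂` IRREDUCIBLE.  The sets `K_i = N₂ + (N₁ ∩ M_i)` increase from `N₂` to
`N₁`; let `i` be least with `N₁ ∩ M_{i+1} ⊄ N₂` (so `N₁ ∩ M_i ⊆ N₂`).  On `W = N₁ ∩ M_{i+1}` the two maps `φ : W → N₁∕N₂` and `ψ : W → M_{i+1}∕M_i` are non-zero, hence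
SURJECTIVE (irreducible targets), and `ker ψ = N₁ ∩ M_i ⊆ N₂ ∩ W = ker φ`; so `φ` factors through `ψ` as a surjective intertwining map `M_{i+1}∕M_i → N₁∕N₂` between
irreducibles — an isomorphism.  Hence the class of `N₁∕N₂` is the class of the `i`-th factor.  Combined with ★ A2 (`tr π = Σ_i tr(M_{i+1}∕M_i)`): the character of an
admissible finite-length `π` is the sum of the characters of finitely many irreducible admissible constituents `r i`, AND every constituent of `π` is one of the `r i`.

* §1 **`exists_equiv_factor_of_covBy_chain`** — the Schreier step above (any field `k`, any group);
* §2 **`exists_smoothIrrep_factors_complete`** — ★ A2 §4 strengthened by «`∀ c, c.IsConstituentOf π → ∃ i, c = ⟦r i⟧`».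

HONEST LABEL: HC_CM is proved only modulo the 7 printed citations (2 remaining named inputs: hLiu418 = stmt-HodgeConjecture-24832, h413 =
stmt-HodgeConjecture-24833) until rung 0 closes; count-neutral helper.

## References
* [BernsteinZelevinsky1976] I. N. Bernstein, A. V. Zelevinsky, *Representations of the group GL(n,F) where F is a non-archimedean local field*, Russ. Math. Surveys 31:3 (1976): §2.3.
* [Casselman1995] W. Casselman, *Introduction to the theory of admissible representations of p-adic reductive groups* (notes, 1995): §2.1.
-/

set_option autoImplicit false
set_option linter.dupNamespace false

noncomputable section

open MeasureTheory

namespace Summit.HodgeConjecture.HodgeConjecture.Cruxes.H413.K2E3SmoothTraceJordanHolder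

open Literature.NumberTheory.Automorphic Literature.RepresentationTheory.FiniteGroups
open Summit.HodgeConjecture.HodgeConjecture.Cruxes.H413.K2E3SmoothTraceCompositionSeries

/-! ## §1 The Schreier step: an irreducible subquotient is isomorphic to a factor of any covering chain -/

section Schreier

variable {k V : Type*} {G : Type} [Field k] [Group G] [AddCommGroup V] [Module k V] {ρ : Representation k G V}

/-- The inclusion `N ∩ M ↪ N` followed by the quotient map `N ↠ N∕N'`, as a `G`-map from `π|_{N ∩ M}` (any subrepresentation `W ≤ N`) to the subquotient
`N∕N'`. [folklore] -/
theorem exists_intertwiningMap_toRepresentation_quotientRep (N N' W : Subrepresentation ρ) (hW : W ≤ N) :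
    ∃ φ : W.toRepresentation.IntertwiningMap (Subrepresentation.comapSubtype ρ N N').quotientRep,
      (∀ w : W.toSubmodule, φ w = (Subrepresentation.comapSubtype ρ N N').mkQ ⟨(w : V), hW w.2⟩) := by
  refine ⟨{ toFun := fun w => (Subrepresentation.comapSubtype ρ N N').mkQ ⟨(w : V), hW w.2⟩
            map_add' := fun a b => by
              rw [← map_add]; rfl
            map_smul' := fun c a => by
              rw [RingHom.id_apply, ← map_smul]; rfl
            isIntertwining' := fun g => LinearMap.ext fun w => ?_ }, fun w => rfl⟩
  change (Subrepresentation.comapSubtype ρ N N').mkQ ⟨(W.toRepresentation g w : V), _⟩ =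
    (Subrepresentation.comapSubtype ρ N N').quotientRep g ((Subrepresentation.comapSubtype ρ N N').mkQ ⟨(w : V), hW w.2⟩)
  rw [← Representation.IntertwiningMap.isIntertwining]
  rfl

/-- **SCHREIER STEP (Jordan–Hölder, uniqueness half).**  For subrepresentations `N₂ ≤ N₁` of `π` with IRREDUCIBLE subquotient `N₁∕N₂` and a covering chain
`⊥ = M₀ ⋖ M₁ ⋖ ⋯ ⋖ M_n = ⊤`, some factor `M_{i+1}∕M_i` (`i < n`) is ISOMORPHIC to `N₁∕N₂`: with `i` least such that `N₁ ⊓ M_{i+1} ≰ N₂`, the inclusion-quotient maps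
`N₁ ⊓ M_{i+1} → N₁∕N₂` and `→ M_{i+1}∕M_i` are surjective (non-zero into irreducibles), the kernel `N₁ ⊓ M_i` of the second lies in `N₂`, and the induced surjection
`M_{i+1}∕M_i ↠ N₁∕N₂` between irreducibles is injective. [cite: BernsteinZelevinsky1976, §2.3] [cite: Casselman1995, §2.1] -/
theorem exists_equiv_factor_of_covBy_chain (N₁ N₂ : Subrepresentation ρ)
    (hirr : (Subrepresentation.comapSubtype ρ N₁ N₂).quotientRep.IsIrreducible)
    {n : ℕ} (M : ℕ → Subrepresentation ρ) (h0 : M 0 = ⊥) (hn : M n = ⊤) (hstep : ∀ i < n, M i ⋖ M (i + 1)) :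
    ∃ i < n, Nonempty ((Subrepresentation.comapSubtype ρ (M (i + 1)) (M i)).quotientRep.Equiv
      (Subrepresentation.comapSubtype ρ N₁ N₂).quotientRep) := by
  classical
  haveI := hirr
  ------------------------------------------------------------------
  -- an irreducible quotient is non-zero: `N₁ ≰ N₂`
  ------------------------------------------------------------------
  have hNtriv : ¬ (N₁ ≤ N₂) := by
    intro hle
    have htop : (Subrepresentation.comapSubtype ρ N₁ N₂).toSubmodule = ⊤ := by
      rw [eq_top_iff]
      intro v _
      exact hle v.2
    have hsub : Subsingleton (↥N₁.toSubmodule ⧸ (Subrepresentation.comapSubtype ρ N₁ N₂).toSubmodule) :=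
      Submodule.Quotient.subsingleton_iff.2 htop
    have hss : Subsingleton (Subrepresentation (Subrepresentation.comapSubtype ρ N₁ N₂).quotientRep) :=
      ⟨fun a b => Subrepresentation.toSubmodule_injective (((Submodule.subsingleton_iff k).2 hsub).elim _ _)⟩
    obtain ⟨a, b, hab⟩ := exists_pair_ne (Subrepresentation (Subrepresentation.comapSubtype ρ N₁ N₂).quotientRep)
    exact hab (Subsingleton.elim a b)
  ------------------------------------------------------------------
  -- the least index `i + 1` with `N₁ ⊓ M (i+1) ≰ N₂`
  ------------------------------------------------------------------
  have hbad_n : ¬ (N₁ ⊓ M n ≤ N₂) := by rw [hn, inf_top_eq]; exact hNtriv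
  have hgood0 : N₁ ⊓ M 0 ≤ N₂ := by rw [h0, inf_bot_eq]; exact bot_le
  have hex : ∃ j, ¬ (N₁ ⊓ M j ≤ N₂) := ⟨n, hbad_n⟩
  have hjP : ¬ (N₁ ⊓ M (Nat.find hex) ≤ N₂) := Nat.find_spec hex
  have hj0 : Nat.find hex ≠ 0 := by
    intro h
    rw [h] at hjP
    exact hjP hgood0
  obtain ⟨i, hi⟩ := Nat.exists_eq_succ_of_ne_zero hj0
  have hjn : Nat.find hex ≤ n := Nat.find_min' hex hbad_n
  have hin : i < n := by omega
  have hgood_i : N₁ ⊓ M i ≤ N₂ := by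
    have h := Nat.find_min hex (show i < Nat.find hex by omega)
    exact not_not.1 h
  have hbad : ¬ (N₁ ⊓ M (i + 1) ≤ N₂) := by
    have h := hjP
    rwa [hi] at h
  refine ⟨i, hin, ?_⟩
  ------------------------------------------------------------------
  -- the two maps out of `W = N₁ ⊓ M (i+1)`
  ------------------------------------------------------------------
  haveI hirr₂ : (Subrepresentation.comapSubtype ρ (M (i + 1)) (M i)).quotientRep.IsIrreducible :=
    isIrreducible_quotientRep_comapSubtype_of_covBy (M i) (M (i + 1)) (hstep i hin)
  obtain ⟨φ, hφ⟩ := exists_intertwiningMap_toRepresentation_quotientRep N₁ N₂ (N₁ ⊓ M (i + 1)) inf_le_left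
  obtain ⟨ψ, hψ⟩ := exists_intertwiningMap_toRepresentation_quotientRep (M (i + 1)) (M i) (N₁ ⊓ M (i + 1)) inf_le_right
  -- `φ ≠ 0`, hence surjective
  obtain ⟨v, hvW, hvN₂⟩ : ∃ v ∈ N₁ ⊓ M (i + 1), v ∉ N₂ := Set.not_subset.1 hbad
  have hφne : φ ⟨v, hvW⟩ ≠ 0 := by
    rw [hφ, Ne, Subrepresentation.mkQ_eq_zero_iff]
    exact hvN₂
  have hφsurj : Function.Surjective φ :=
    (Representation.IntertwiningMap.surjective_or_eq_zero φ).resolve_right fun h => hφne (by rw [h]; rfl)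
  -- `ψ ≠ 0`, hence surjective
  have hWnot : ¬ (N₁ ⊓ M (i + 1) ≤ M i) := fun hle => hbad fun w hw => hgood_i ⟨hw.1, hle hw⟩
  obtain ⟨v', hv'W, hv'M⟩ : ∃ v ∈ N₁ ⊓ M (i + 1), v ∉ M i := Set.not_subset.1 hWnot
  have hψne : ψ ⟨v', hv'W⟩ ≠ 0 := by
    rw [hψ, Ne, Subrepresentation.mkQ_eq_zero_iff]
    exact hv'M
  have hψsurj : Function.Surjective ψ :=
    (Representation.IntertwiningMap.surjective_or_eq_zero ψ).resolve_right fun h => hψne (by rw [h]; rfl)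
  -- `ker ψ ≤ ker φ` (`N₁ ⊓ M i ≤ N₂`)
  have hker : LinearMap.ker ψ.toLinearMap ≤ LinearMap.ker φ.toLinearMap := by
    intro w hw
    rw [LinearMap.mem_ker, Representation.IntertwiningMap.toLinearMap_apply] at hw ⊢
    rw [hψ, Subrepresentation.mkQ_eq_zero_iff] at hw
    rw [hφ, Subrepresentation.mkQ_eq_zero_iff]
    exact hgood_i ⟨w.2.1, hw⟩
  ------------------------------------------------------------------
  -- the induced surjection `χ : M (i+1) ∕ M i → N₁ ∕ N₂`, an isomorphism between irreducibles
  ------------------------------------------------------------------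
  let χlin := ((LinearMap.ker ψ.toLinearMap).liftQ φ.toLinearMap hker) ∘ₗ
    (ψ.toLinearMap.quotKerEquivOfSurjective hψsurj).symm.toLinearMap
  have hχψ : ∀ w, χlin (ψ w) = φ w := fun w => by
    show (LinearMap.ker ψ.toLinearMap).liftQ φ.toLinearMap hker
        ((ψ.toLinearMap.quotKerEquivOfSurjective hψsurj).symm (ψ.toLinearMap w)) = φ w
    rw [LinearMap.quotKerEquivOfSurjective_symm_apply, Submodule.liftQ_apply]
    rfl
  clear_value χlin
  let χ : Representation.IntertwiningMap (Subrepresentation.comapSubtype ρ (M (i + 1)) (M i)).quotientRep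
      (Subrepresentation.comapSubtype ρ N₁ N₂).quotientRep :=
    { toLinearMap := χlin
      isIntertwining' := fun g => LinearMap.ext fun q => by
        obtain ⟨w, rfl⟩ := hψsurj q
        rw [LinearMap.comp_apply, LinearMap.comp_apply, ← Representation.IntertwiningMap.isIntertwining _ _ ψ g w, hχψ, hχψ]
        exact Representation.IntertwiningMap.isIntertwining _ _ φ g w }
  have hχψ' : ∀ w, χ (ψ w) = φ w := hχψ
  have hχsurj : Function.Surjective χ := fun q => by
    obtain ⟨w, rfl⟩ := hφsurj q
    exact ⟨ψ w, hχψ' w⟩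
  have hχinj : Function.Injective χ :=
    (Representation.IsIrreducible.injective_or_eq_zero χ).resolve_right fun h => hφne (by rw [← hχψ', h]; rfl)
  exact ⟨Representation.IntertwiningMap.ofBijective χ ⟨hχinj, hχsurj⟩⟩

end Schreier

/-! ## §2 The character as a sum over a COMPLETE list of irreducible constituents -/

section Package

variable {G : Type} [Group G] [TopologicalSpace G] [IsTopologicalGroup G] [MeasurableSpace G] [BorelSpace G]
  {V : Type} [AddCommGroup V] [Module ℂ V] {ρ : Representation ℂ G V}

/-- **BRICK A2′ (JH) — THE CHARACTER OF AN ADMISSIBLE FINITE-LENGTH REPRESENTATION IS THE SUM OF THE CHARACTERS OF ITS COMPOSITION FACTORS, AND EVERY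
CONSTITUENT IS ONE OF THEM.**  For `π` smooth admissible on `V : Type` with `IsFiniteLength ℂ[G] π.asModule` there are `n` and irreducible smooth admissible
`r₀, …, r_{n−1}`, each a constituent of `π`, with `π.smoothTrace μ f = Σ_i ⟦r i⟧.smoothTrace μ f` (every `μ` finite on compacts, every `f`) — ★ A2 — and, NEW,
`∀ c, c.IsConstituentOf π → ∃ i, c = ⟦r i⟧` (§1 applied to the covering chain behind the `r i`). [cite: BernsteinZelevinsky1976, §2.3] [cite: Casselman1995, §2.1]
[cite: BernsteinZelevinsky1977, §2.3] -/
theorem exists_smoothIrrep_factors_complete (hadm : ρ.IsAdmissible)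
    (hfl : IsFiniteLength (MonoidAlgebra ℂ G) ρ.asModule) :
    ∃ (n : ℕ) (r : Fin n → SmoothIrrep G),
      (∀ i, (IrrClass.mk (r i)).IsConstituentOf ρ) ∧ (∀ i, (r i).ρ.IsAdmissible) ∧
      (∀ (μ : Measure G) [IsFiniteMeasureOnCompacts μ] (f : G → ℂ),
        ρ.smoothTrace μ f = ∑ i, (IrrClass.mk (r i)).smoothTrace μ f) ∧
      ∀ c : IrrClass G, c.IsConstituentOf ρ → ∃ i, c = IrrClass.mk (r i) := by
  obtain ⟨n, N, hN, h0, hn, hstep⟩ := exists_covBy_chain_of_isFiniteLength ρ hfl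
  -- the `i`-th composition factor as a bundled irreducible smooth representation (as in ★ A2 §4)
  let r : Fin n → SmoothIrrep G := fun i =>
    { V := ↥(N ((i : ℕ) + 1)).toSubmodule ⧸ (Subrepresentation.comapSubtype ρ (N ((i : ℕ) + 1)) (N (i : ℕ))).toSubmodule
      ρ := (Subrepresentation.comapSubtype ρ (N ((i : ℕ) + 1)) (N (i : ℕ))).quotientRep
      isIrreducible := isIrreducible_quotientRep_comapSubtype_of_covBy (N (i : ℕ)) (N ((i : ℕ) + 1)) (hstep i i.2)
      isSmooth := (hadm.1.toRepresentation (N ((i : ℕ) + 1))).quotientRep _ }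
  refine ⟨n, r, fun i => ?_, fun i => ?_, fun μ _ f => ?_, fun c hc => ?_⟩
  · exact IrrClass.isConstituentOf_mk (r i) ρ (N ((i : ℕ) + 1)) (N (i : ℕ)) (hN (Nat.le_succ _)) (Representation.Equiv.refl _)
  · exact (hadm.toRepresentation (N ((i : ℕ) + 1))).quotientRep _
  · rw [smoothTrace_eq_sum_range_of_chain μ hadm N hN h0 hn f, Finset.sum_range]
    rfl
  · -- completeness: Jordan–Hölder
    obtain ⟨r', hr'c, N₁, N₂, -, ⟨e⟩⟩ := hc
    have hirr : (Subrepresentation.comapSubtype ρ N₁ N₂).quotientRep.IsIrreducible :=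
      (Representation.Equiv.isIrreducible_iff e).1 r'.isIrreducible
    obtain ⟨i, hi, ⟨E⟩⟩ := exists_equiv_factor_of_covBy_chain N₁ N₂ hirr N h0 hn hstep
    refine ⟨⟨i, hi⟩, ?_⟩
    rw [← hr'c]
    exact IrrClass.mk_eq_mk_of_equiv (e.trans E.symm)

end Package


end Summit.HodgeConjecture.HodgeConjecture.Cruxes.H413.K2E3SmoothTraceJordanHolder

end
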